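/-
Copyright: literature formalisation for the harness. Statements follow the cited text.
-/
import Literature.AlgebraicGeometry.CossartPiltant200819.TameDescent2008
import Mathlib.LinearAlgebra.Matrix.Transvection
import Mathlib.Algebra.Field.ZMod
import Mathlib.Algebra.Order.Floor.Ring
import Mathlib.NumberTheory.Real.Irrational
import HarnessLib

/-!
# Cossart–Piltant I (2008), Lemma 9.4 — the lattice step (HAL p. 30, l. 23–31): legal moves

V. Cossart, O. Piltant, *Resolution of singularities of threefolds in positive characteristic I*,
J. Algebra 320 (2008) 1051–1082 [CossartPiltant2008]; manuscript hal-00139124 ("HAL"). In the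
proof of Lemma 9.4 (HAL p. 30, l. 23–31; journal Lemma 9.2) the authors assert, "by elementary
linear algebra", the existence of a basis `(v₁,v₂,v₃)` of `ℤ³` with (a) `(l v₁, v₂, v₃)` a basis of
the character lattice `N`, (b) `ℕ³ ⊆ Σ ℕ vᵢ`, (c) `Σⱼ vᵢⱼ W(xⱼ) ≥ 0` — the statement
`CP2008.LatticeABC d l t w` of `TameDescent2008` (there: FALSE for `d = 2`,
`not_latticeABC_two_five`; one instance for `d = 3`, `latticeABC_three_five_golden`; the
finishing criterion `latticeABC_of_good`).

This is the first of three files (`LatticeMoves2008`, `LatticeEuclid2008`,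
`LatticeReservoir2008`) giving a kernel proof of the statement for EVERY `d ≥ 3` (all primes
`l`, all nonzero character vectors `t`, all positive real weight vectors `w`:
`latticeABC_of_three_le`). It sets up the elementary "coin game" of the reading notes:

* `Lattice94.Adm w V C` — an ADMISSIBLE STATE: a unimodular pair `V C = C V = 1` over `ℤ` with
  `C ≥ 0` entrywise (property (b)) and `V w ≥ 0` (property (c)); the row functionals
  `Lattice94.rw V w i = vᵢ · w` ("coins") and `Lattice94.rt V t i = vᵢ · t ∈ ℤ/l` ("charges").
* LEGAL MOVES preserving admissibility: `Adm.transvect` (row operation `vᵢ ← vᵢ − m vⱼ`, i.e.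
  column operation `cⱼ ← cⱼ + m cᵢ` on `C`, legal iff `m · (vⱼ·w) ≤ vᵢ·w`; Mathlib
  `Matrix.transvection`) and `Adm.perm` (relabelling the basis).
* FINISHING CRITERIA (from `latticeABC_of_good`, `l` prime): `Adm.abc_of_dominant` (a row `k`
  of nonzero charge such that every other row is either of charge `0` or has coin
  `≥ (l−1) ·` coin `k`), `Adm.abc_of_zero` (a row of nonzero charge and coin `0`),
  `Adm.abc_of_neutral` (a row of charge `0` and small positive coin next to a charged row).
* `Adm.t_eq_sum`, `Adm.exists_rt_ne_zero`: `t = C (V t)`, so some charge is nonzero if `t ≠ 0`.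
* `latticeABC_of_commensurable`: the statement holds in ANY number of variables `d` when the
  weights are commensurable (`w = g · m`, `m ∈ ℕ^d`) and `t ≠ 0` — by the subtractive Euclidean
  algorithm on all coins at once (induction on `Σ mᵢ`); with
  `exists_commensurable_of_forall_not_irrational` (pairwise rational ratios ⇒ commensurable)
  this is the case "`r = 1`" of the reading notes.
* `latticeABC_comp_perm`: invariance of `LatticeABC` under relabelling the variables.

Nothing here is specific to dimension three; the dimension enters in `LatticeReservoir2008`
(a third coin is needed as a reservoir when two weights have irrational ratio — the exact point
where the printed "elementary linear algebra" uses `d = 3`, cf. `not_latticeABC_two_five`).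
Cell record: pub-hironaka GAPS §GA G7-A21.L / F2. No statement of [CossartPiltant2008] is
contradicted by anything in this file.

## Sources

* V. Cossart, O. Piltant, J. Algebra 320 (2008), Lemma 9.2 = HAL hal-00139124 Lemma 9.4, proof,
  p. 30, l. 23–31. [CossartPiltant2008]
-/

noncomputable section

namespace Literature.AlgebraicGeometry.CossartPiltant200819.CP2008

open Matrix

namespace Lattice94

variable {d l : ℕ}

/-! ### Row functionals ("coins" and "charges") and admissible states -/

/-- The real functional of row `i` of `V` against the weights: `vᵢ · w` (the "coin" of row `i`;
property (c) of HAL p. 30, l. 27 asks `vᵢ · w ≥ 0`). [folklore] -/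
def rw (V : Matrix (Fin d) (Fin d) ℤ) (w : Fin d → ℝ) (i : Fin d) : ℝ :=
  ∑ j, (V i j : ℝ) * w j

/-- The character of row `i` of `V`: `vᵢ · t ∈ ℤ/l` (the "charge" of row `i`; property (a) of
HAL p. 30, l. 26 asks that all rows but one kill `t`). [folklore] -/
def rt (V : Matrix (Fin d) (Fin d) ℤ) (t : Fin d → ZMod l) (i : Fin d) : ZMod l :=
  ∑ j, ((V i j : ℤ) : ZMod l) * t j

/-- An ADMISSIBLE STATE of the coin game: `V` and `C` are mutually inverse integer matrices,
`C ≥ 0` entrywise (property (b): `ℕ^d ⊆ Σ ℕ vᵢ`) and every coin `vᵢ · w` is `≥ 0`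
(property (c)). [folklore] -/
structure Adm (w : Fin d → ℝ) (V C : Matrix (Fin d) (Fin d) ℤ) : Prop where
  /-- `V C = 1`. -/
  mul : V * C = 1
  /-- `C V = 1`. -/
  mul' : C * V = 1
  /-- Property (b): `C ≥ 0` entrywise. -/
  nonneg : ∀ i j, 0 ≤ C i j
  /-- Property (c): every coin `vᵢ · w` is `≥ 0`. -/
  row : ∀ i, 0 ≤ rw V w i

/-- The coin of row `i` of the identity matrix is `wᵢ`. [folklore] -/
theorem rw_one (w : Fin d → ℝ) (i : Fin d) : rw (1 : Matrix (Fin d) (Fin d) ℤ) w i = w i := by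
  classical
  simp [rw, Matrix.one_apply]

/-- The charge of row `i` of the identity matrix is `tᵢ`. [folklore] -/
theorem rt_one (t : Fin d → ZMod l) (i : Fin d) : rt (1 : Matrix (Fin d) (Fin d) ℤ) t i = t i := by
  classical
  simp [rt, Matrix.one_apply]

/-- The initial state `V = C = 1` is admissible when all weights are `≥ 0`. [folklore] -/
theorem Adm.one {w : Fin d → ℝ} (hw : ∀ i, 0 ≤ w i) :
    Adm w (1 : Matrix (Fin d) (Fin d) ℤ) 1 :=
  ⟨Matrix.mul_one _, Matrix.mul_one _, fun i j => by
    rw [Matrix.one_apply]; split_ifs <;> norm_num, fun i => by rw [rw_one]; exact hw i⟩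

/-! ### The two legal moves -/

/-- Coins after the row operation `vᵢ ← vᵢ + c vⱼ`. [folklore] -/
theorem rw_transvection_mul (i j : Fin d) (c : ℤ) (V : Matrix (Fin d) (Fin d) ℤ)
    (w : Fin d → ℝ) (a : Fin d) :
    rw (transvection i j c * V) w a = rw V w a + if a = i then (c : ℝ) * rw V w j else 0 := by
  by_cases ha : a = i
  · subst ha
    simp only [rw, transvection_mul_apply_same, Int.cast_add, Int.cast_mul, add_mul,
      Finset.sum_add_distrib, if_true, Finset.mul_sum, mul_assoc]
  · simp only [rw, if_neg ha, add_zero]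
    refine Finset.sum_congr rfl fun b _ => ?_
    rw [transvection_mul_apply_of_ne i j a b ha]

/-- Charges after the row operation `vᵢ ← vᵢ + c vⱼ`. [folklore] -/
theorem rt_transvection_mul (i j : Fin d) (c : ℤ) (V : Matrix (Fin d) (Fin d) ℤ)
    (t : Fin d → ZMod l) (a : Fin d) :
    rt (transvection i j c * V) t a = rt V t a + if a = i then (c : ZMod l) * rt V t j else 0 := by
  by_cases ha : a = i
  · subst ha
    simp only [rt, transvection_mul_apply_same, Int.cast_add, Int.cast_mul, add_mul,
      Finset.sum_add_distrib, if_true, Finset.mul_sum, mul_assoc]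
  · simp only [rt, if_neg ha, add_zero]
    refine Finset.sum_congr rfl fun b _ => ?_
    rw [transvection_mul_apply_of_ne i j a b ha]

/-- **Legal move 1** (HAL p. 30 reading notes: "`cⱼ ← cⱼ + m cᵢ`"): for `i ≠ j` and `m ∈ ℕ` with
`m · (vⱼ·w) ≤ vᵢ·w`, the state `(T(−m) V, C T(m))` (`T = transvection i j`) is again
admissible; its coins and charges are given by `rw_transvection_mul`, `rt_transvection_mul`.
[folklore] -/
theorem Adm.transvect {w : Fin d → ℝ} {V C : Matrix (Fin d) (Fin d) ℤ} (h : Adm w V C)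
    {i j : Fin d} (hij : i ≠ j) (m : ℕ) (hle : (m : ℝ) * rw V w j ≤ rw V w i) :
    Adm w (transvection i j (-(m : ℤ)) * V) (C * transvection i j (m : ℤ)) := by
  refine ⟨?_, ?_, ?_, ?_⟩
  · calc transvection i j (-(m : ℤ)) * V * (C * transvection i j (m : ℤ))
        = transvection i j (-(m : ℤ)) * (V * C) * transvection i j (m : ℤ) := by
          simp only [Matrix.mul_assoc]
      _ = 1 := by
          rw [h.mul, Matrix.mul_one, transvection_mul_transvection_same i j hij, neg_add_cancel,
            transvection_zero]
  · calc C * transvection i j (m : ℤ) * (transvection i j (-(m : ℤ)) * V)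
        = C * (transvection i j (m : ℤ) * transvection i j (-(m : ℤ))) * V := by
          simp only [Matrix.mul_assoc]
      _ = 1 := by
          rw [transvection_mul_transvection_same i j hij, add_neg_cancel, transvection_zero,
            Matrix.mul_one, h.mul']
  · intro a b
    by_cases hb : b = j
    · subst hb
      rw [mul_transvection_apply_same]
      exact add_nonneg (h.nonneg a b) (mul_nonneg (Int.natCast_nonneg m) (h.nonneg a i))
    · rw [mul_transvection_apply_of_ne i j a b hb]
      exact h.nonneg a b
  · intro a
    rw [rw_transvection_mul]
    by_cases ha : a = i
    · rw [if_pos ha, ha, Int.cast_neg, Int.cast_natCast]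
      linarith
    · rw [if_neg ha, add_zero]
      exact h.row a

/-- Coins after relabelling the rows by `σ`. [folklore] -/
theorem rw_submatrix (σ : Equiv.Perm (Fin d)) (V : Matrix (Fin d) (Fin d) ℤ) (w : Fin d → ℝ)
    (a : Fin d) : rw (V.submatrix σ id) w a = rw V w (σ a) := by
  simp [rw, Matrix.submatrix_apply]

/-- Charges after relabelling the rows by `σ`. [folklore] -/
theorem rt_submatrix (σ : Equiv.Perm (Fin d)) (V : Matrix (Fin d) (Fin d) ℤ)
    (t : Fin d → ZMod l) (a : Fin d) : rt (V.submatrix σ id) t a = rt V t (σ a) := by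
  simp [rt, Matrix.submatrix_apply]

/-- **Legal move 2**: relabelling the basis (rows of `V`, columns of `C`) by a permutation keeps
the state admissible. [folklore] -/
theorem Adm.perm {w : Fin d → ℝ} {V C : Matrix (Fin d) (Fin d) ℤ} (h : Adm w V C)
    (σ : Equiv.Perm (Fin d)) : Adm w (V.submatrix σ id) (C.submatrix id σ) := by
  refine ⟨?_, ?_, ?_, ?_⟩
  · ext a b
    rw [Matrix.mul_apply]
    simp only [Matrix.submatrix_apply, id]
    rw [← Matrix.mul_apply, h.mul]
    simp [Matrix.one_apply, σ.injective.eq_iff]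
  · ext a b
    rw [Matrix.mul_apply]
    simp only [Matrix.submatrix_apply, id]
    rw [Equiv.sum_comp σ (fun j => C a j * V j b), ← Matrix.mul_apply, h.mul']
  · intro a b
    exact h.nonneg a (σ b)
  · intro a
    rw [rw_submatrix]
    exact h.row (σ a)

/-! ### Finishing criteria (`l` prime) -/

/-- **GOOD ⇒ (a)(b)(c)** (wrapper of `latticeABC_of_good` for `l` prime): an admissible state
with a row `k` of nonzero charge such that every other row has charge `0` or coin at least
`(l − 1)` times the coin of row `k` yields `LatticeABC` (with `Pᵢ :=` the least residue of
`τᵢ/τ_k`, `Pᵢ ≤ l − 1`). [folklore] -/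
theorem Adm.abc_of_dominant [Fact l.Prime] {t : Fin d → ZMod l} {w : Fin d → ℝ}
    {V C : Matrix (Fin d) (Fin d) ℤ} (h : Adm w V C) (k : Fin d) (hk : rt V t k ≠ 0)
    (hdom : ∀ i, i ≠ k → rt V t i = 0 ∨ ((l : ℝ) - 1) * rw V w k ≤ rw V w i) :
    LatticeABC d l t w := by
  classical
  haveI : NeZero l := ⟨(Fact.out : l.Prime).ne_zero⟩
  refine latticeABC_of_good t w V C h.mul h.nonneg h.row k
    (fun i => (rt V t i * (rt V t k)⁻¹).val) hk ?_ ?_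
  · intro i _
    change rt V t i = ((rt V t i * (rt V t k)⁻¹).val : ZMod l) * rt V t k
    rw [ZMod.natCast_zmod_val, inv_mul_cancel_right₀ hk]
  · intro i hi
    change (((rt V t i * (rt V t k)⁻¹).val : ℕ) : ℝ) * rw V w k ≤ rw V w i
    rcases hdom i hi with h0 | hle
    · rw [h0, zero_mul, ZMod.val_zero, Nat.cast_zero, zero_mul]
      exact h.row i
    · have hP : (((rt V t i * (rt V t k)⁻¹).val : ℕ) : ℝ) ≤ (l : ℝ) - 1 := by
        have h1 := ZMod.val_lt (rt V t i * (rt V t k)⁻¹)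
        have h2 : (((rt V t i * (rt V t k)⁻¹).val : ℕ) : ℝ) + 1 ≤ (l : ℝ) := by
          exact_mod_cast h1
        linarith
      calc (((rt V t i * (rt V t k)⁻¹).val : ℕ) : ℝ) * rw V w k
          ≤ ((l : ℝ) - 1) * rw V w k := mul_le_mul_of_nonneg_right hP (h.row k)
        _ ≤ rw V w i := hle

/-- A row of nonzero charge and coin `0` finishes the game (all `Pᵢ · 0 ≤ vᵢ·w`). [folklore] -/
theorem Adm.abc_of_zero [Fact l.Prime] {t : Fin d → ZMod l} {w : Fin d → ℝ}
    {V C : Matrix (Fin d) (Fin d) ℤ} (h : Adm w V C) (k : Fin d) (hk : rt V t k ≠ 0)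
    (h0 : rw V w k = 0) : LatticeABC d l t w :=
  h.abc_of_dominant k hk fun i _ => Or.inr (by rw [h0, mul_zero]; exact h.row i)

/-- `t = C (V t)`: the charges of an admissible state determine `t`. [folklore] -/
theorem Adm.t_eq_sum {w : Fin d → ℝ} {V C : Matrix (Fin d) (Fin d) ℤ} (h : Adm w V C)
    (t : Fin d → ZMod l) (j : Fin d) : t j = ∑ i, ((C j i : ℤ) : ZMod l) * rt V t i := by
  classical
  have key := castSum_mul_apply (S := ZMod l) C V t j
  rw [h.mul'] at key
  change _ = ∑ i, ((C j i : ℤ) : ZMod l) * ∑ m, ((V i m : ℤ) : ZMod l) * t m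
  rw [← key]
  simp [Matrix.one_apply]

/-- If `t ≠ 0`, some row of an admissible state has nonzero charge. [folklore] -/
theorem Adm.exists_rt_ne_zero {w : Fin d → ℝ} {V C : Matrix (Fin d) (Fin d) ℤ} (h : Adm w V C)
    {t : Fin d → ZMod l} (ht : t ≠ 0) : ∃ k, rt V t k ≠ 0 := by
  by_contra hall
  push Not at hall
  apply ht
  funext j
  rw [h.t_eq_sum t j]
  simp [hall]

/-- `1 ≤ l − 1` as a real number, for `l` prime. [folklore] -/
theorem one_le_cast_prime_sub_one [Fact l.Prime] : (1 : ℝ) ≤ (l : ℝ) - 1 := by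
  have h2 := (Fact.out : l.Prime).two_le
  have : (2 : ℝ) ≤ (l : ℝ) := by exact_mod_cast h2
  linarith

/-- **The neutral-coin lemma** of the reading notes: a row `z` of charge `0` with positive coin,
a row `c ≠ z` of nonzero charge, and every third row of charge `0` or of coin `≥ (l−1) ·` coin
`z`: reduce the coin of `c` modulo the coin of `z` (charge unchanged) — then row `c` is dominant.
[folklore] -/
theorem Adm.abc_of_neutral [Fact l.Prime] {t : Fin d → ZMod l} {w : Fin d → ℝ}
    {V C : Matrix (Fin d) (Fin d) ℤ} (h : Adm w V C) {z c : Fin d} (hcz : c ≠ z)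
    (hz : rt V t z = 0) (hzpos : 0 < rw V w z) (hc : rt V t c ≠ 0)
    (hdom : ∀ i, i ≠ c → i ≠ z → rt V t i = 0 ∨ ((l : ℝ) - 1) * rw V w z ≤ rw V w i) :
    LatticeABC d l t w := by
  set m : ℕ := ⌊rw V w c / rw V w z⌋₊ with hm
  have hle : (m : ℝ) * rw V w z ≤ rw V w c := by
    have h1 := Nat.floor_le (div_nonneg (h.row c) hzpos.le)
    rw [← hm] at h1
    rwa [le_div_iff₀ hzpos] at h1
  have hlt : rw V w c - m * rw V w z < rw V w z := by
    have h1 := Nat.lt_floor_add_one (rw V w c / rw V w z)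
    rw [← hm, div_lt_iff₀ hzpos] at h1
    linarith
  have h' := h.transvect hcz m hle
  have hl := one_le_cast_prime_sub_one (l := l)
  apply h'.abc_of_dominant (t := t) c
  · rw [rt_transvection_mul, if_pos rfl, hz, mul_zero, add_zero]
    exact hc
  · intro i hi
    rw [rw_transvection_mul, rw_transvection_mul, if_neg hi, if_pos rfl, rt_transvection_mul,
      if_neg hi, add_zero, add_zero]
    by_cases hiz : i = z
    · left
      rw [hiz]
      exact hz
    · rcases hdom i hi hiz with h0 | hle'
      · exact Or.inl h0
      · right
        calc ((l : ℝ) - 1) * (rw V w c + ((-(m : ℤ) : ℤ) : ℝ) * rw V w z)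
            ≤ ((l : ℝ) - 1) * rw V w z := by
              apply mul_le_mul_of_nonneg_left _ (by linarith)
              push_cast
              linarith
          _ ≤ rw V w i := hle'

/-! ### Commensurable weights: any number of variables -/

/-- Bookkeeping for the subtractive step: replacing `mᵢ` by `mᵢ − mⱼ` lowers `Σ m` by `mⱼ`.
[folklore] -/
theorem sum_update_sub {m : Fin d → ℕ} {i j : Fin d} (hji : m j ≤ m i) :
    (∑ a, if a = i then m i - m j else m a) + m j = ∑ a, m a := by
  classical
  have h1 := (Finset.add_sum_erase Finset.univ (fun a => if a = i then m i - m j else m a)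
    (Finset.mem_univ i)).symm
  have h2 := (Finset.add_sum_erase Finset.univ m (Finset.mem_univ i)).symm
  have h3 : ∑ a ∈ Finset.univ.erase i, (fun a => if a = i then m i - m j else m a) a
      = ∑ a ∈ Finset.univ.erase i, m a := by
    refine Finset.sum_congr rfl fun a ha => ?_
    have : a ≠ i := Finset.ne_of_mem_erase ha
    simp [this]
  simp only [if_true] at h1
  rw [h1, h2, h3]
  omega

/-- The coin game with COMMENSURABLE coins (`vᵢ·w = g mᵢ`, `mᵢ ∈ ℕ`, `g > 0`) is won from any
admissible state when `t ≠ 0`: subtract a smallest positive coin from another positive coin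
(induction on `Σ mᵢ`); when at most one coin is positive, a charged row has coin `0` or is the
only charged row. [folklore] -/
theorem Adm.abc_of_commensurable [Fact l.Prime] {t : Fin d → ZMod l} (ht : t ≠ 0) {g : ℝ}
    (hg : 0 < g) : ∀ (N : ℕ) {w : Fin d → ℝ} {V C : Matrix (Fin d) (Fin d) ℤ} (m : Fin d → ℕ),
      Adm w V C → (∀ i, rw V w i = g * m i) → ∑ i, m i ≤ N → LatticeABC d l t w := by
  intro N
  induction N with
  | zero =>
    intro w V C m h hm hN
    obtain ⟨k, hk⟩ := h.exists_rt_ne_zero ht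
    have hmk : m k = 0 := by
      have := Finset.single_le_sum (fun a _ => Nat.zero_le (m a)) (Finset.mem_univ k)
      omega
    exact h.abc_of_zero k hk (by rw [hm k, hmk, Nat.cast_zero, mul_zero])
  | succ N ih =>
    intro w V C m h hm hN
    by_cases hex : ∃ i j, i ≠ j ∧ 0 < m j ∧ m j ≤ m i
    · obtain ⟨i, j, hij, hj, hji⟩ := hex
      have hle : ((1 : ℕ) : ℝ) * rw V w j ≤ rw V w i := by
        rw [Nat.cast_one, one_mul, hm i, hm j]
        exact mul_le_mul_of_nonneg_left (by exact_mod_cast hji) hg.le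
      have h' := h.transvect hij 1 hle
      refine ih (fun a => if a = i then m i - m j else m a) h' (fun a => ?_) ?_
      · rw [rw_transvection_mul]
        by_cases ha : a = i
        · rw [if_pos ha, if_pos ha, ha, hm i, hm j, Nat.cast_sub hji]
          push_cast
          ring
        · rw [if_neg ha, if_neg ha, add_zero, hm a]
      · have := sum_update_sub (m := m) hji
        omega
    · push Not at hex
      -- at most one coin is positive
      obtain ⟨k, hk⟩ := h.exists_rt_ne_zero ht
      by_cases hmk : m k = 0
      · exact h.abc_of_zero k hk (by rw [hm k, hmk, Nat.cast_zero, mul_zero])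
      · have hothers : ∀ i, i ≠ k → m i = 0 := by
          intro i hi
          by_contra hmi
          rcases le_total (m i) (m k) with hik | hki
          · exact absurd hik (not_le.mpr (hex k i (Ne.symm hi) (Nat.pos_of_ne_zero hmi)))
          · exact absurd hki (not_le.mpr (hex i k hi (Nat.pos_of_ne_zero hmk)))
        by_cases hall : ∀ i, i ≠ k → rt V t i = 0
        · exact h.abc_of_dominant k hk fun i hi => Or.inl (hall i hi)
        · push Not at hall
          obtain ⟨i, hi, hri⟩ := hall
          exact h.abc_of_zero i hri (by rw [hm i, hothers i hi, Nat.cast_zero, mul_zero])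

end Lattice94

open Lattice94 in
/-- **The lattice step for commensurable weights, any number `d` of variables**: if
`w = g · m` with `g > 0`, `m ∈ ℕ^d`, and `t ≠ 0`, then `LatticeABC d l t w` (`l` prime). This is
case "`r = 1`" (rank-one rational value group restricted to the `xⱼ`) of the reading notes to
HAL p. 30, l. 23–31; it does not use `d ≥ 3`. [folklore] -/
theorem latticeABC_of_commensurable {d l : ℕ} [Fact l.Prime] (t : Fin d → ZMod l)
    (w : Fin d → ℝ) (ht : t ≠ 0) (g : ℝ) (hg : 0 < g) (m : Fin d → ℕ)
    (hw : ∀ i, w i = g * m i) : LatticeABC d l t w :=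
  Adm.abc_of_commensurable ht hg (∑ i, m i) m
    (Adm.one fun i => by rw [hw i]; positivity) (fun i => by rw [rw_one, hw i]) le_rfl

/-- Pairwise rational ratios of positive reals make them commensurable. [folklore] -/
theorem exists_commensurable_of_forall_not_irrational {d : ℕ} (w : Fin d → ℝ)
    (hw : ∀ i, 0 < w i) (hrat : ∀ i j, ¬ Irrational (w i / w j)) :
    ∃ g : ℝ, 0 < g ∧ ∃ m : Fin d → ℕ, ∀ i, w i = g * m i := by
  rcases isEmpty_or_nonempty (Fin d) with hd | ⟨⟨i₀⟩⟩
  · exact ⟨1, one_pos, fun i => 0, fun i => (IsEmpty.false i).elim⟩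
  · have hq : ∀ j, ∃ q : ℚ, (q : ℝ) = w j / w i₀ := fun j => by
      have := hrat j i₀
      unfold Irrational at this
      push Not at this
      exact this
    choose q hq using hq
    have hqpos : ∀ j, 0 < q j := fun j => by
      have : (0 : ℝ) < q j := by rw [hq j]; exact div_pos (hw j) (hw i₀)
      exact_mod_cast this
    set D : ℕ := ∏ j, (q j).den with hD
    have hDpos : 0 < D := Finset.prod_pos fun j _ => (q j).den_pos
    have hdvd : ∀ j, (q j).den ∣ D := fun j => Finset.dvd_prod_of_mem _ (Finset.mem_univ j)
    refine ⟨w i₀ / D, div_pos (hw i₀) (by exact_mod_cast hDpos),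
      fun j => (q j).num.toNat * (D / (q j).den), fun j => ?_⟩
    have hnum : (((q j).num.toNat : ℕ) : ℝ) = ((q j).num : ℝ) := by
      have h0 : 0 ≤ (q j).num := le_of_lt (Rat.num_pos.mpr (hqpos j))
      exact_mod_cast Int.toNat_of_nonneg h0
    have hden : (q j).den ≠ 0 := (q j).den_pos.ne'
    have hcast : (((D / (q j).den : ℕ) : ℕ) : ℝ) = (D : ℝ) / ((q j).den : ℝ) :=
      Nat.cast_div (hdvd j) (by exact_mod_cast hden)
    have hwj : w j = (q j : ℝ) * w i₀ := by
      rw [hq j, div_mul_cancel₀ _ (hw i₀).ne']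
    have hqj : ((q j : ℚ) : ℝ) = ((q j).num : ℝ) / ((q j).den : ℝ) := Rat.cast_def (q j)
    rw [hwj, hqj, Nat.cast_mul, hnum, hcast]
    have hD' : (D : ℝ) ≠ 0 := by exact_mod_cast hDpos.ne'
    have hden' : ((q j).den : ℝ) ≠ 0 := by exact_mod_cast hden
    field_simp

/-- `LatticeABC` is invariant under relabelling the variables. [folklore] -/
theorem latticeABC_comp_perm {d l : ℕ} {t : Fin d → ZMod l} {w : Fin d → ℝ}
    (σ : Equiv.Perm (Fin d)) (h : LatticeABC d l (t ∘ σ) (w ∘ σ)) : LatticeABC d l t w := by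
  obtain ⟨V, C, i₀, hVC, hC, ha, hker, hi₀⟩ := h
  refine ⟨V.submatrix id σ.symm, C.submatrix σ.symm id, i₀, ?_, ?_, ?_, ?_, ?_⟩
  · ext a b
    rw [Matrix.mul_apply]
    simp only [Matrix.submatrix_apply, id]
    rw [Equiv.sum_comp σ.symm (fun j => V a j * C j b), ← Matrix.mul_apply, hVC]
  · intro a b
    exact hC (σ.symm a) b
  · intro a
    have := ha a
    simp only [Function.comp] at this
    rw [← Equiv.sum_comp σ]
    simpa [Matrix.submatrix_apply] using this
  · intro a hai
    have := hker a hai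
    simp only [Function.comp] at this
    rw [← Equiv.sum_comp σ]
    simpa [Matrix.submatrix_apply] using this
  · have := hi₀
    simp only [Function.comp] at this
    rw [← Equiv.sum_comp σ]
    simpa [Matrix.submatrix_apply] using this

end Literature.AlgebraicGeometry.CossartPiltant200819.CP2008

end
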